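import Literature.Analysis.FluidPDE.AxisymmetricTypeIInfinity
import Literature.Analysis.FluidPDE.CKNEpsilonRegularityDivFree
import Literature.Analysis.FluidPDE.CKNLocalRegularityRRSPressure
import HarnessLib

/-!
# `typeI_boundedNearTop_infinity` from the local pressure estimate (Robinson–Rodrigo–Sadowski
# 2016, Lemma 15.12): the input at infinity reduced to the single unproved leaf

Analysis/FluidPDE proofs-layer file (theorems only, **no definitions, no named facts**) in the
decomposition of `Literature.Analysis.FluidPDE.knss_no_axisymmetric_typeI` (`Axisymmetric.lean`)
through `axisymmetric_typeI_bounded` (`KNSSTypeII.lean`) and its three local inputs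
(`AxisymmetricTypeIBounded.lean`). The input at spatial infinity,
`typeI_boundedNearTop_infinity`, is proved in `AxisymmetricTypeIInfinity.lean` from the accepted
one-scale ε-regularity criterion `lemarieRieusset_epsilon_regularity` (Lemarié-Rieusset 2016,
Thm. 14.4, with a force `f ∈ L^q`, `q > 5/2`) — an unproved named fact. Only its **unforced case**
is used there (the classical solution of `AxisymmetricTypeIHyp` has `f = 0`), and the unforced case
of Thm. 14.4 is a THEOREM of the tree modulo one named fact:
`lemarieRieusset_epsilon_regularity_zeroForce_of_lemma15_12 : RRS2016.lemma15_12 → …`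
(`CKNEpsilonRegularityDivFree.lean`; below it the proved Robinson–Rodrigo–Sadowski induction
`RRS2016.theorem15_3_of_lemma15_12`, `lemma15_11_holds`, `step2_force_holds`,
`step3_of_lemma15_12`, the viscosity and scale normalisations). This file records the resulting
reduction of the input at infinity to that single leaf, the local pressure estimate
`RRS2016.lemma15_12` (Robinson–Rodrigo–Sadowski 2016, Lemma 15.12, proof p. 234; the
Calderón–Zygmund step of Caffarelli–Kohn–Nirenberg's Proposition 1):

* `typeI_boundedNearTop_infinity_of_zeroForce` — the argument of
  `typeI_boundedNearTop_infinity_of_LR` run from the unforced one-scale criterion alone, stated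
  with the criterion (in the bundled form `IsLRSuitableWeakSolutionOn Ω ν 3 0 u p G` of
  `lemarieRieusset_epsilon_regularity_iff`, force `0`, exponent `q = 3`) as an explicit
  hypothesis;
* `typeI_boundedNearTop_infinity_of_lemma15_12 :
    RRS2016.lemma15_12 → typeI_boundedNearTop_infinity`.

* `typeI_boundedNearTop_infinity_holds` — **the discharge**: with the tree's theorem
  `RRS2016.lemma15_12_holds` (`CKNLocalRegularityRRSPressure.lean`, Lemma 15.12 proved by the
  Newtonian potential, Stein's `L³` Hessian bound in dual form and the mean-value property), the
  named fact `typeI_boundedNearTop_infinity` is a theorem: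
  `typeI_boundedNearTop_infinity_of_lemma15_12 RRS2016.lemma15_12_holds`.

Nothing is asserted; the trust base of `typeI_boundedNearTop_infinity_holds` is empty (axioms
`propext`, `Classical.choice`, `Quot.sound`).

## The argument (as in `AxisymmetricTypeIInfinity.lean`)

Let `H : AxisymmetricTypeIHyp ν T u p`, `q` its gauged pressure (`exists_gauged_pressure`),
`r₀ = √T / 2`. On each cylinder `Q = Q_{r₀}(T, x₀)` the standing hypotheses of the criterion hold
with force `0` (energy class from the energy inequality; the weak gradient of the local energy
inequality is square integrable because it agrees a.e. with the Leray–Hopf gradient;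
`q ∈ L^{3/2}(Q)`); the smallness `∫∫_Q (|u|³ + |q|^{3/2}) ≤ ε₀³ r₀²` holds for `|x₀|` large by the
tails of `u ∈ L³` of the final strip and of the normalised pressure
(`exists_radius_cylinder_enorm_pow_three_lt`, `lintegral_cylinder_gauged_pressure_le_tail`,
`tendsto_lintegral_tail_normalisedPressure_rpow`); the criterion bounds `u` a.e. by `C₀ ε₀ / r₀`
on `Q_{r₀/2}(T, x₀)`, hence everywhere there by continuity.

## References

* J. C. Robinson, J. L. Rodrigo, W. Sadowski, *The three-dimensional Navier–Stokes equations*,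
  Cambridge Studies in Advanced Mathematics 157 (2016), Lemma 15.12 (p. 232, proof p. 234) and
  Thm. 15.3 (p. 220). [RobinsonRodrigoSadowski2016]
* P. G. Lemarié-Rieusset, *The Navier–Stokes Problem in the 21st Century*, CRC Press 2016,
  Thm. 14.4 (p. 505), case `f = 0`. [LemarieRieusset2016]
* L. Caffarelli, R. Kohn, L. Nirenberg, Comm. Pure Appl. Math. 35 (1982), Prop. 1, Cor. 1.
  [CaffarelliKohnNirenberg1982]
-/

noncomputable section

open MeasureTheory Set Function Filter Topology TopologicalSpace Metric
open scoped NNReal ENNReal InnerProductSpace RealInnerProductSpace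

namespace Literature.Analysis.FluidPDE

/-- **The input at infinity from the unforced one-scale ε-regularity criterion.** If for every
viscosity `ν > 0` there are `ε₀, C₀ > 0` such that every `(u, p)` in the standing class of
Lemarié-Rieusset's §14.3 with force `0` on a domain `Ω`
(`IsLRSuitableWeakSolutionOn Ω ν 3 0 u p G`) with `∫∫_{Q_{r₀}(z₀)} (|u|³ + |p|^{3/2}) ≤ λ³ r₀²`,
`0 ≤ λ ≤ ε₀`, `Q_{r₀}(z₀) ⊆ Ω`, obeys `|u| ≤ C₀ λ / r₀` a.e. on `Q_{r₀/2}(z₀)` (the case `f = 0`,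
`q = 3` of Thm. 14.4), then `typeI_boundedNearTop_infinity` holds. The proof is that of
`typeI_boundedNearTop_infinity_of_LR`, which only ever applies the criterion with `f = 0`.
[cite: LemarieRieusset2016, Thm. 14.4 p. 505, case f = 0] -/
theorem typeI_boundedNearTop_infinity_of_zeroForce
    (h0 : ∀ ν : ℝ, 0 < ν → ∃ ε₀ C₀ : ℝ, 0 < ε₀ ∧ 0 < C₀ ∧
      ∀ (Ω : Opens (ℝ × EuclideanSpace ℝ (Fin 3)))
        (u : ℝ → EuclideanSpace ℝ (Fin 3) → EuclideanSpace ℝ (Fin 3))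
        (p : ℝ → EuclideanSpace ℝ (Fin 3) → ℝ)
        (G : ℝ → EuclideanSpace ℝ (Fin 3) →
          EuclideanSpace ℝ (Fin 3) →L[ℝ] EuclideanSpace ℝ (Fin 3)),
        IsLRSuitableWeakSolutionOn Ω ν 3 0 u p G →
        ∀ (z₀ : ℝ × EuclideanSpace ℝ (Fin 3)) (r₀ l : ℝ), 0 < r₀ →
          parabolicCylinder r₀ z₀ ⊆ (Ω : Set (ℝ × EuclideanSpace ℝ (Fin 3))) →
          0 ≤ l → l ≤ ε₀ →
          ∫⁻ w in parabolicCylinder r₀ z₀,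
              (‖u w.1 w.2‖ₑ ^ (3 : ℕ) + ‖p w.1 w.2‖ₑ ^ (3 / 2 : ℝ)) ≤
            ENNReal.ofReal (l ^ 3 * r₀ ^ 2) →
          ∀ᵐ w ∂(volume.restrict (parabolicCylinder (r₀ / 2) z₀)),
            ‖u w.1 w.2‖ ≤ C₀ * l / r₀) :
    typeI_boundedNearTop_infinity := by
  intro ν T u p H
  have hν := H.viscosity_pos
  have hT := H.time_pos
  obtain ⟨ε₀, C₀, hε₀, hC₀, hcrit⟩ := h0 ν hν
  -- the scale
  set r₀ : ℝ := Real.sqrt T / 2 with hr₀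
  have hr₀pos : 0 < r₀ := by positivity
  have hr₀T : r₀ ^ 2 ≤ T := by
    rw [hr₀, div_pow, Real.sq_sqrt hT.le]; linarith
  -- the smallness budget
  set η : ℝ≥0∞ := ENNReal.ofReal (ε₀ ^ 3 * r₀ ^ 2) / 2 with hη
  have hηpos : 0 < η := ENNReal.half_pos (ENNReal.ofReal_pos.2 (by positivity)).ne'
  -- the gauged pressure
  obtain ⟨q, hsuit, hqae, -⟩ := H.exists_gauged_pressure
  -- far field of `u`
  obtain ⟨n₁, hn₁⟩ := H.exists_radius_cylinder_enorm_pow_three_lt hr₀T hηpos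
  -- far field of `q`
  have hvol : volume (ball (0 : EuclideanSpace ℝ (Fin 3)) r₀) ^ (1 / 4 : ℝ) ≠ ∞ :=
    ENNReal.rpow_ne_top_of_nonneg (by norm_num) measure_ball_lt_top.ne
  have htail := ENNReal.Tendsto.const_mul H.tendsto_lintegral_tail_normalisedPressure_rpow
    (Or.inr hvol) (a := volume (ball (0 : EuclideanSpace ℝ (Fin 3)) r₀) ^ (1 / 4 : ℝ))
  rw [mul_zero] at htail
  obtain ⟨n₂, hn₂⟩ := ((tendsto_order.1 htail).2 η hηpos).exists
  -- the square-integrable weak gradient of the Leray–Hopf solution on the slab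
  obtain ⟨G', hG'slab, -, hG'int, -⟩ := H.lerayHopf.exists_hasWeakSpatialGradientOn
  -- conclusion
  refine ⟨max (n₁ : ℝ) n₂ + r₀, r₀ / 2, C₀ * ε₀ / r₀, by positivity, fun t ht x hx => ?_⟩
  -- the cylinder about `(T, x)`
  set Q : Opens (ℝ × EuclideanSpace ℝ (Fin 3)) := parabolicCylinderOpens r₀ ((T : ℝ), x)
    with hQdef
  have hQ : (Q : Set (ℝ × EuclideanSpace ℝ (Fin 3))) = parabolicCylinder r₀ ((T : ℝ), x) := rfl
  have hQslab : (Q : Set (ℝ × EuclideanSpace ℝ (Fin 3))) ⊆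
      Ioo 0 T ×ˢ (univ : Set (EuclideanSpace ℝ (Fin 3))) := by
    intro z hz
    rw [hQ, mem_parabolicCylinder] at hz
    exact ⟨⟨by nlinarith [hz.1.1], hz.1.2⟩, mem_univ _⟩
  have hQle : Q ≤ slab (EuclideanSpace ℝ (Fin 3)) (Ioo 0 T) isOpen_Ioo := fun z hz => by
    rw [mem_slab]; exact (hQslab hz).1
  have hsws := hsuit Q hQslab
  obtain ⟨G₀, hG₀, -, hloc⟩ := hsws.localEnergy
  -- `∫_Q |G₀|² < ∞` through the Leray–Hopf gradient
  have hG₀int : ∫⁻ w in (Q : Set (ℝ × EuclideanSpace ℝ (Fin 3))),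
      ENNReal.ofReal (frobeniusNormSq (G₀ w.1 w.2)) < ∞ := by
    have hae : ∀ᵐ w ∂(volume.restrict (Q : Set (ℝ × EuclideanSpace ℝ (Fin 3)))),
        ENNReal.ofReal (frobeniusNormSq (G₀ w.1 w.2)) =
          ENNReal.ofReal (frobeniusNormSq (G' w.1 w.2)) := by
      filter_upwards [hG₀.ae_eq (hG'slab.mono hQle)] with w hw
      change ENNReal.ofReal (frobeniusNormSq (uncurry G₀ w)) =
        ENNReal.ofReal (frobeniusNormSq (uncurry G' w))
      rw [hw]
    rw [lintegral_congr_ae hae]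
    refine lt_of_le_of_lt (lintegral_mono_set ?_) hG'int
    rw [hQ]
    exact hQslab
  -- the energy class in indicator form
  set CE : ℝ≥0 := Real.toNNReal (2 * VectorCalculus.kineticEnergy (u 0)) with hCE
  have hCEind : ∀ᵐ s : ℝ, ∫⁻ y, (Q : Set (ℝ × EuclideanSpace ℝ (Fin 3))).indicator
      (fun w : ℝ × EuclideanSpace ℝ (Fin 3) => ‖u w.1 w.2‖ₑ ^ 2) (s, y) ≤ CE := by
    rw [hQ, parabolicCylinder]
    refine ae_lintegral_indicator_prod_le measurableSet_ball (ae_of_all _ fun s hs => ?_)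
    have hsI : s ∈ Ico 0 T := ⟨by nlinarith [hs.1], hs.2⟩
    calc ∫⁻ y in ball x r₀, ‖u s y‖ₑ ^ 2 ≤ eEnergy (u s) := setLIntegral_le_lintegral _ _
      _ ≤ ENNReal.ofReal (2 * VectorCalculus.kineticEnergy (u 0)) := H.eEnergy_le hsI
      _ = CE := rfl
  have hp' : ∫⁻ w in (Q : Set (ℝ × EuclideanSpace ℝ (Fin 3))),
      ‖q w.1 w.2‖ₑ ^ (3 / 2 : ℝ) < ∞ := by
    rw [hQ]; exact H.lintegral_cylinder_gauged_pressure_lt_top hqae hr₀T x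
  -- the zero force
  have hfq : MemLp (uncurry (0 : ℝ → EuclideanSpace ℝ (Fin 3) → EuclideanSpace ℝ (Fin 3)))
      (ENNReal.ofReal 3) (volume.restrict (Q : Set (ℝ × EuclideanSpace ℝ (Fin 3)))) :=
    (MemLp.zero : MemLp (0 : ℝ × EuclideanSpace ℝ (Fin 3) → EuclideanSpace ℝ (Fin 3))
      (ENNReal.ofReal 3) (volume.restrict (Q : Set (ℝ × EuclideanSpace ℝ (Fin 3)))))
  -- the standing hypotheses of §14.3 on `Q`, force `0`, exponent `3`
  have hLR : IsLRSuitableWeakSolutionOn Q ν 3 0 u q G₀ :=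
    ⟨by rw [hQ]; exact isConnected_parabolicCylinder hr₀pos _, ⟨CE, hCEind⟩, hG₀, hG₀int, hp',
      hfq, hsws.distributional, hloc⟩
  -- smallness on the far cylinder `Q_{r₀}(T, x)`, `|x| ≥ max n₁ n₂ + r₀`
  have hx₁ : (n₁ : ℝ) + r₀ ≤ ‖x‖ := by linarith [le_max_left (n₁ : ℝ) n₂]
  have hx₂ : (n₂ : ℝ) + r₀ ≤ ‖x‖ := by linarith [le_max_right (n₁ : ℝ) n₂]
  have hmeas_u : AEMeasurable (fun w : ℝ × EuclideanSpace ℝ (Fin 3) => ‖u w.1 w.2‖ₑ ^ (3 : ℕ))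
      (volume.restrict (parabolicCylinder r₀ ((T : ℝ), x))) := by
    have h1 : AEStronglyMeasurable (uncurry u)
        (volume.restrict (parabolicCylinder r₀ ((T : ℝ), x))) :=
      hsws.distributional.1.aestronglyMeasurable
    exact (h1.aemeasurable.enorm.pow_const 3)
  have hint : ∫⁻ w in parabolicCylinder r₀ ((T : ℝ), x),
      (‖u w.1 w.2‖ₑ ^ (3 : ℕ) + ‖q w.1 w.2‖ₑ ^ (3 / 2 : ℝ)) ≤ ENNReal.ofReal (ε₀ ^ 3 * r₀ ^ 2) := by
    rw [lintegral_add_left' hmeas_u]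
    have hu3 : ∫⁻ w in parabolicCylinder r₀ ((T : ℝ), x), ‖u w.1 w.2‖ₑ ^ (3 : ℕ) ≤ η :=
      (hn₁ x hx₁).le
    have hq32 : ∫⁻ w in parabolicCylinder r₀ ((T : ℝ), x), ‖q w.1 w.2‖ₑ ^ (3 / 2 : ℝ) ≤ η :=
      (H.lintegral_cylinder_gauged_pressure_le_tail hqae hr₀T n₂ hx₂).trans (hn₂).le
    calc (∫⁻ w in parabolicCylinder r₀ ((T : ℝ), x), ‖u w.1 w.2‖ₑ ^ (3 : ℕ)) +
          ∫⁻ w in parabolicCylinder r₀ ((T : ℝ), x), ‖q w.1 w.2‖ₑ ^ (3 / 2 : ℝ)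
        ≤ η + η := add_le_add hu3 hq32
      _ = ENNReal.ofReal (ε₀ ^ 3 * r₀ ^ 2) := ENNReal.add_halves _
  -- the criterion
  have hbdd := hcrit Q u q G₀ hLR ((T : ℝ), x) r₀ ε₀ hr₀pos (by rw [hQ]) hε₀.le le_rfl hint
  -- everywhere on `Q_{r₀/2}(T, x)` by continuity
  have hUopen : IsOpen (parabolicCylinder (r₀ / 2) ((T : ℝ), x)) := isOpen_parabolicCylinder _ _
  have hUslab : parabolicCylinder (r₀ / 2) ((T : ℝ), x) ⊆
      Ioo 0 T ×ˢ (univ : Set (EuclideanSpace ℝ (Fin 3))) := by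
    intro z hz
    rw [mem_parabolicCylinder] at hz
    exact ⟨⟨by nlinarith [hz.1.1], hz.1.2⟩, mem_univ _⟩
  have hcont : ContinuousOn (fun z : ℝ × EuclideanSpace ℝ (Fin 3) => u z.1 z.2)
      (parabolicCylinder (r₀ / 2) ((T : ℝ), x)) :=
    H.classical_Ioo.smooth_velocity.continuousOn.mono hUslab
  have hall := SereginSverak2009.forall_le_of_ae_le_of_continuousOn hUopen hcont.norm
    continuousOn_const hbdd
  have hmem : ((t, x) : ℝ × EuclideanSpace ℝ (Fin 3)) ∈
      parabolicCylinder (r₀ / 2) ((T : ℝ), x) := by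
    rw [mem_parabolicCylinder]
    exact ⟨ht, by simp only [dist_self]; positivity⟩
  have := hall (t, x) hmem
  simpa only [mul_div_assoc] using this

/-- **The input at infinity from the local pressure estimate**: `typeI_boundedNearTop_infinity`
(`AxisymmetricTypeIBounded.lean`) follows from the single named fact `RRS2016.lemma15_12`
(Robinson–Rodrigo–Sadowski 2016, Lemma 15.12), through the proved unforced case of
Lemarié-Rieusset's Thm. 14.4 (`lemarieRieusset_epsilon_regularity_zeroForce_of_lemma15_12`,
exponent `q = 3`) and `typeI_boundedNearTop_infinity_of_zeroForce`.
[cite: RobinsonRodrigoSadowski2016, Lemma 15.12 p. 232; LemarieRieusset2016, Thm. 14.4 p. 505] -/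
theorem typeI_boundedNearTop_infinity_of_lemma15_12 (h12 : RRS2016.lemma15_12) :
    typeI_boundedNearTop_infinity :=
  typeI_boundedNearTop_infinity_of_zeroForce fun _ hν =>
    lemarieRieusset_epsilon_regularity_zeroForce_of_lemma15_12 h12 hν (by norm_num)

/-- **Discharge of `typeI_boundedNearTop_infinity`.** Under the standing hypotheses
`AxisymmetricTypeIHyp ν T u p` (classical Leray–Hopf solution on `[0, T)`, bounded on sub-slabs,
Type I rate at `T`) the velocity is bounded on `(T − r², T) × {‖x‖ ≥ R}` for some `R`, `r > 0`:
the one-scale ε-regularity criterion of Caffarelli–Kohn–Nirenberg (Prop. 1 / Cor. 1) in the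
unforced `L³ × L^{3/2}` form of Lemarié-Rieusset's Thm. 14.4 — a theorem of the tree through
Robinson–Rodrigo–Sadowski's Thm. 15.3 and the proved Lemma 15.12 (`RRS2016.lemma15_12_holds`) —
applied on the far cylinders `Q_{√T/2}(T, x)`, where `∫∫ (|u|³ + |q|^{3/2})` is small by the tails
of `u ∈ L³` and of the gauged Riesz pressure (`typeI_boundedNearTop_infinity_of_lemma15_12`).
[cite: LemarieRieusset2016, Thm. 14.4 p. 505, case f = 0; RobinsonRodrigoSadowski2016, Thm. 15.3 p. 220 and Lemma 15.12 pp. 232–234; CaffarelliKohnNirenberg1982, Prop. 1 and Cor. 1] -/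
theorem typeI_boundedNearTop_infinity_holds : typeI_boundedNearTop_infinity :=
  typeI_boundedNearTop_infinity_of_lemma15_12 RRS2016.lemma15_12_holds

end Literature.Analysis.FluidPDE

end
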